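import Mathlib
import Summits.MatrixMultiplication.MatrixMultiplication.Theorems.AbelianSTPPSieveVP
import Summits.MatrixMultiplication.MatrixMultiplication.Theorems.AbelianSTPPCensusVPSharp338

/-!
# The vP shape census for T_E fails at EVERY order `M ≥ 6144` (instrument ceiling, asymptotic side, in the kernel)

W2 (cell mm-stpp, planner gen 7, HOME/mm-stpp-plan/calc/w2-g7/W2-RESULT.md §2) found numerically that every order `M ≥ 1322` carries a
vP-admissible uniform family beating `5/2`.  This file proves the analytic tail as a theorem: for `M ≥ 6144` the uniform family
`(16,16,16) × k`, `k = ⌊M/768⌋`, satisfies every clause of `SieveAdmissible`, all forms of U11-G and U11-P (packing slack `M ≥ 768k`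
swallows Grynkiewicz's and Pollard's floors), and beats `5/2` (`k · 4096^{5/6} = 1024k > M`).  Consequently NO statement of the shape
`∀ N M' a b c, 2 ≤ N → M' ≤ M → SieveAdmissibleVP M' a b c → ¬ Beats (5/2) M' a b c` holds for any `M ≥ 6144`
(`vpCensusTE_false_above_6144`): the rule set {vM, U11-G, U11-P} cannot push an abelian T_E census to large orders — a barrier-type
fact for this METHOD (uniform families with `3ks² ≤ M` are immune to the sumset rules), not a statement about STPPs or ω.
Companions: `shapeExclusionVP_false_at_338` (first failure), `shapeExclusionVP_false_at_prime_521` (first prime failure).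
-/

-- single-conjunct summit: the mandated namespace repeats `MatrixMultiplication`.
set_option linter.dupNamespace false

namespace Summit.MatrixMultiplication.MatrixMultiplication.Theorems

namespace AbelianSTPPCensusVP

open Finset

/-- the constant size-16 list on `k` members -/
def c16 (k : ℕ) : Fin k → ℕ := fun _ => 16

section sums
variable (k : ℕ)

/-- Evaluation of the constant list. [bookkeeping] -/
@[simp] theorem c16_apply (i : Fin k) : c16 k i = 16 := rfl

/-- `P_AB` of the uniform list. [bookkeeping] -/
theorem pAB_c16 : pAB (c16 k) (c16 k) (c16 k) = 256 * k := by
  simp [pAB, c16, sum_const, card_univ, Fintype.card_fin, mul_comm]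

/-- `P_BC` of the uniform list. [bookkeeping] -/
theorem pBC_c16 : pBC (c16 k) (c16 k) (c16 k) = 256 * k := by
  simp [pBC, c16, sum_const, card_univ, Fintype.card_fin, mul_comm]

/-- `P_CA` of the uniform list. [bookkeeping] -/
theorem pCA_c16 : pCA (c16 k) (c16 k) (c16 k) = 256 * k := by
  simp [pCA, c16, sum_const, card_univ, Fintype.card_fin, mul_comm]

/-- The ceiling `UB_B(t)` of the uniform list. [bookkeeping] -/
theorem ubB_c16 (M t : ℕ) : ubB M (c16 k) (c16 k) (c16 k) t = 256 * min t 16 * k + t * (M - 256 * k) := by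
  simp [ubB, pCA_c16, c16, sum_const, card_univ, Fintype.card_fin]
  ring

/-- The member volume of the uniform list. [bookkeeping] -/
theorem shapeVol_c16 (i : Fin k) : shapeVol (c16 k) (c16 k) (c16 k) i = 4096 := by
  simp [shapeVol, c16]

/-- The U14 sum of the uniform list. [bookkeeping] -/
theorem u14Sum_c16 (i : Fin k) :
    u14Sum (shapeVol (c16 k) (c16 k) (c16 k)) (c16 k) (c16 k) i = 4096 + 256 * (k - 1) := by
  simp [u14Sum, shapeVol_c16, c16, sum_const, card_erase_of_mem (mem_univ i), card_univ, Fintype.card_fin, mul_comm]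

end sums

/-- U11-G form B for the uniform family under packing slack `768 k ≤ M`. -/
theorem u11GFormB_c16 {M k : ℕ} (hM : 768 * k ≤ M) : U11GFormB M (c16 k) (c16 k) (c16 k) := by
  intro t h2 _ _ _
  simp only [pAB_c16, pBC_c16, ubB_c16]
  have hsub : t * (M - 256 * k) + t * (256 * k) = t * M := by
    rw [← mul_add]; congr 1; omega
  have h1 : t * (768 * k) ≤ t * M := Nat.mul_le_mul_left t hM
  have h0 : 0 ≤ 256 * min t 16 * k := Nat.zero_le _
  have htt : 1 ≤ t * t := Nat.one_le_iff_ne_zero.mpr (by positivity)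
  refine ⟨fun ht => ?_, fun ht => ?_⟩
  · subst ht; nlinarith [hsub, h1, h0]
  · have hsq : 2 * t ^ 2 = 2 * (t * t) := by ring
    rw [hsq]; nlinarith [hsub, h1, h0, htt]

/-- U11-P form B for the uniform family under packing slack `768 k ≤ M`. -/
theorem u11PFormB_c16 {M k : ℕ} (hM : 768 * k ≤ M) : U11PFormB M (c16 k) (c16 k) (c16 k) := by
  intro t _ _ _
  simp only [pAB_c16, pBC_c16, ubB_c16]
  have hsub : t * (M - 256 * k) + t * (256 * k) = t * M := by
    rw [← mul_add]; congr 1; omega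
  have h1 : t * (768 * k) ≤ t * M := Nat.mul_le_mul_left t hM
  have hmin : t * min M (256 * k + 256 * k - t) ≤ t * (512 * k) :=
    Nat.mul_le_mul_left t ((min_le_right _ _).trans (by omega))
  have h0 : 0 ≤ 256 * min t 16 * k := Nat.zero_le _
  nlinarith [hmin, h1, h0, hsub]

/-- The uniform family is vM-admissible for `M ≥ 6144`, `k = ⌊M/768⌋`. -/
theorem sieveAdmissible_c16 {M : ℕ} (hM : 6144 ≤ M) : SieveAdmissible M (c16 (M / 768)) (c16 (M / 768)) (c16 (M / 768)) := by
  set k := M / 768 with hk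
  have hk8 : 8 ≤ k := by omega
  have hkM : 768 * k ≤ M := by omega
  dsimp only [SieveAdmissible]
  refine ⟨fun i => ?_, fun i => ?_, ?_, fun i => ?_, fun i j _ => ?_, fun l => ?_, fun l => ?_⟩
  · simp [shapeVol_c16]; omega
  · simp; omega
  · refine ⟨?_, ?_, ?_⟩ <;> simp [sum_const, card_univ, Fintype.card_fin] <;> omega
  · refine ⟨?_, ?_, ?_⟩ <;> simp [sum_const, card_univ, Fintype.card_fin] <;> omega
  · simp [shapeVol_c16]; omega
  · have hd : u14Sum (shapeVol (c16 k) (c16 k) (c16 k)) (c16 k) (c16 k) l = M → HasLargeCommonDivisor 4096 M 16 := by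
      intro h; rw [u14Sum_c16] at h; exact ⟨256, by norm_num, by norm_num, ⟨k + 15, by omega⟩⟩
    have hle : u14Sum (shapeVol (c16 k) (c16 k) (c16 k)) (c16 k) (c16 k) l ≤ M := by rw [u14Sum_c16]; omega
    simp only [shapeVol_c16, c16_apply] at hd ⊢
    exact ⟨hle, hd, hle, hd, hle, hd⟩
  · have hd : u14Sum (shapeVol (c16 k) (c16 k) (c16 k)) (c16 k) (c16 k) l = M → HasLargeCommonDivisor 4096 M (16 * 16) := by
      intro h; rw [u14Sum_c16] at h; exact ⟨256, by norm_num, by norm_num, ⟨k + 15, by omega⟩⟩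
    simp only [shapeVol_c16, c16_apply] at hd ⊢
    exact ⟨fun h _ => hd h, fun h _ => hd h, fun h _ => hd h⟩

/-- … and vP-admissible (U11-G, U11-P in all forms: the three rotations coincide for a uniform family). -/
theorem sieveAdmissibleVP_c16 {M : ℕ} (hM : 6144 ≤ M) :
    SieveAdmissibleVP M (c16 (M / 768)) (c16 (M / 768)) (c16 (M / 768)) := by
  have hkM : 768 * (M / 768) ≤ M := by omega
  exact ⟨sieveAdmissible_c16 hM, ⟨u11GFormB_c16 hkM, u11GFormB_c16 hkM, u11GFormB_c16 hkM⟩,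
    fun _ => ⟨u11PFormB_c16 hkM, u11PFormB_c16 hkM, u11PFormB_c16 hkM⟩⟩


/-- The uniform family beats `5/2` for `M ≥ 6144`: `k · 4096^{5/6} ≥ 1024 k > M`. -/
theorem beats_c16 {M : ℕ} (hM : 6144 ≤ M) : Beats (5 / 2) M (c16 (M / 768)) (c16 (M / 768)) (c16 (M / 768)) := by
  set k := M / 768 with hk
  have hkM : M < 1024 * k := by omega
  unfold Beats
  have hexp : ((5 : ℝ) / 2 / 3) = (5 : ℝ) / 6 := by norm_num
  simp only [shapeVol_c16, sum_const, card_univ, Fintype.card_fin, nsmul_eq_mul, hexp]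
  have h1024 : (1024 : ℝ) ≤ ((4096 : ℕ) : ℝ) ^ ((5 : ℝ) / 6) :=
    le_rpow_five_sixths (by norm_num) (by norm_num) (by norm_num)
  have hkR : (M : ℝ) < 1024 * (k : ℝ) := by exact_mod_cast hkM
  have hk0 : (0 : ℝ) ≤ (k : ℝ) := by positivity
  nlinarith [h1024, hkR, hk0]

/-- **For every `M ≥ 6144` the vP census for T_E fails at `M`** (explicit admissible beating family on `⌊M/768⌋ ≥ 8` members). -/
theorem vpCensusTE_fails_above_6144 {M : ℕ} (hM : 6144 ≤ M) :
    ∃ (N : ℕ) (a b c : Fin N → ℕ), 2 ≤ N ∧ SieveAdmissibleVP M a b c ∧ Beats (5 / 2) M a b c :=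
  ⟨M / 768, c16 _, c16 _, c16 _, by omega, sieveAdmissibleVP_c16 hM, beats_c16 hM⟩

/-- Hence no census statement of the crux's shape reaches any order `M ≥ 6144`. -/
theorem vpCensusTE_false_above_6144 {M : ℕ} (hM : 6144 ≤ M) :
    ¬ (∀ (N M' : ℕ) (a b c : Fin N → ℕ), 2 ≤ N → M' ≤ M → SieveAdmissibleVP M' a b c → ¬ Beats (5 / 2) M' a b c) := by
  intro h
  obtain ⟨N, a, b, c, hN, hadm, hb⟩ := vpCensusTE_fails_above_6144 hM
  exact h N M a b c hN le_rfl hadm hb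

end AbelianSTPPCensusVP

end Summit.MatrixMultiplication.MatrixMultiplication.Theorems
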